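import Summits.KontsevichZagierPeriods.KontsevichZagierPeriods.Theorems.MzvKernelInKZTwoPosetsInteriorLandenAux1
import Mathlib.Analysis.SpecialFunctions.Sqrt
import Mathlib.Analysis.SpecialFunctions.Pow.Deriv

/-!
# `GpcLegendreLemniscatic` (stmt-KontsevichZagierPeriods-0280), line `hyperbola-fibration-conic`: stub `stub_pencilCalculus`

Pure real analysis of the conic rationalisation of the hyperbola pencil (move M2 of the line; lead's
file). On the triangle `T = {0 < z1 < z0 < 1}` (fibre coordinate `y = z0`, pencil parameter `t = z1`)
put `w(y,t) = √((y⁴ − t⁴)/(1 − y⁴))` and `Ψ₂ z = update z 0 (w z)`. We prove: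

* `Ψ₂` is injective on `T` (for fixed `t`, `w` determines `y⁴ = (t⁴ + w²)/(1 + w²)`);
* `Ψ₂ '' T` is the half-strip `{0 < z0} ∩ {0 < z1 < 1}` (explicit inverse `y = ((t⁴ + w²)/(1 + w²))^{1/4}`);
* `Ψ₂` is differentiable at every point of `T` with Jacobian determinant
  `∂w/∂y = 2y³(1 − t⁴)/(w(1 − y⁴)²)` (a one-coordinate substitution: tree tool `stub_interiorLandenAux1`);
* the pull-back identity `2y³/(√(1−y⁴)√(y⁴−t⁴)) = (1/(1 + w²))·|∂w/∂y|` on `T`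
  (because `1 + w² = (1 − t⁴)/(1 − y⁴)`): the conic period `∫ dw/(1+w²)` appears fibrewise.

No definitions are introduced (file-local notation only). References: Kontsevich–Zagier 2001 §1.2
rule (2); McKean–Moll 1999 §2.4 (the CM quartic `y² = 1 − x⁴`).
-/

noncomputable section

namespace Summit.KontsevichZagierPeriods.Grothendieck.GpcLegendreLemniscaticLine

open Set
open Summit.KontsevichZagierPeriods.MzvKernelInKZ.TwoPosets.Landen

set_option quotPrecheck false in
/-- The triangle `T = {0 < z1 < z0 < 1}`. -/
local notation "Tri" => {z : Fin 2 → ℝ | 0 < z 1 ∧ z 1 < z 0 ∧ z 0 < 1}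

set_option quotPrecheck false in
/-- The half-strip `{0 < z0} ∩ {0 < z1 < 1}`. -/
local notation "Hst" => {z : Fin 2 → ℝ | 0 < z 0 ∧ 0 < z 1 ∧ z 1 < 1}

/-- The conic coordinate `w(z) = √((z0⁴ − z1⁴)/(1 − z0⁴))`. -/
local notation "wC" => fun z : Fin 2 → ℝ => Real.sqrt ((z 0 ^ 4 - z 1 ^ 4) / (1 - z 0 ^ 4))

/-- The rationalisation map `Ψ₂ z = update z 0 (w z)`. -/
local notation "Ψ₂" => fun z : Fin 2 → ℝ => Function.update z 0 (Real.sqrt ((z 0 ^ 4 - z 1 ^ 4) / (1 - z 0 ^ 4)))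

/-- The Jacobian `∂w/∂y = 2z0³(1 − z1⁴)/(w (1 − z0⁴)²)`. -/
local notation "Jac" => fun z : Fin 2 → ℝ =>
  2 * z 0 ^ 3 * (1 - z 1 ^ 4) / (Real.sqrt ((z 0 ^ 4 - z 1 ^ 4) / (1 - z 0 ^ 4)) * (1 - z 0 ^ 4) ^ 2)

/-! ## Elementary inequalities on the triangle -/

/-- On `T`: `0 < z0`. -/
theorem tri_pos0 {z : Fin 2 → ℝ} (hz : z ∈ Tri) : 0 < z 0 := hz.1.trans hz.2.1

/-- On `T`: `0 < 1 − z0⁴`. -/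
theorem tri_one_sub_pow_pos {z : Fin 2 → ℝ} (hz : z ∈ Tri) : 0 < 1 - z 0 ^ 4 :=
  sub_pos.mpr (pow_lt_one₀ (tri_pos0 hz).le hz.2.2 four_ne_zero)

/-- On `T`: `0 < z0⁴ − z1⁴`. -/
theorem tri_pow_sub_pow_pos {z : Fin 2 → ℝ} (hz : z ∈ Tri) : 0 < z 0 ^ 4 - z 1 ^ 4 :=
  sub_pos.mpr (pow_lt_pow_left₀ hz.2.1 hz.1.le four_ne_zero)

/-- On `T`: `0 < 1 − z1⁴`. -/
theorem tri_one_sub_pow_one_pos {z : Fin 2 → ℝ} (hz : z ∈ Tri) : 0 < 1 - z 1 ^ 4 :=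
  sub_pos.mpr (pow_lt_one₀ hz.1.le (hz.2.1.trans hz.2.2) four_ne_zero)

/-- On `T`: the radicand `(z0⁴ − z1⁴)/(1 − z0⁴)` is positive. -/
theorem tri_radicand_pos {z : Fin 2 → ℝ} (hz : z ∈ Tri) : 0 < (z 0 ^ 4 - z 1 ^ 4) / (1 - z 0 ^ 4) :=
  div_pos (tri_pow_sub_pow_pos hz) (tri_one_sub_pow_pos hz)

/-- On `T`: `w > 0`. -/
theorem tri_w_pos {z : Fin 2 → ℝ} (hz : z ∈ Tri) : 0 < wC z := Real.sqrt_pos.mpr (tri_radicand_pos hz)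

/-- On `T`: `w² = (z0⁴ − z1⁴)/(1 − z0⁴)`. -/
theorem tri_w_sq {z : Fin 2 → ℝ} (hz : z ∈ Tri) : (wC z) ^ 2 = (z 0 ^ 4 - z 1 ^ 4) / (1 - z 0 ^ 4) :=
  Real.sq_sqrt (tri_radicand_pos hz).le

/-- On `T`: `1 + w² = (1 − z1⁴)/(1 − z0⁴)`. -/
theorem tri_one_add_w_sq {z : Fin 2 → ℝ} (hz : z ∈ Tri) :
    1 + (wC z) ^ 2 = (1 - z 1 ^ 4) / (1 - z 0 ^ 4) := by
  rw [tri_w_sq hz]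
  field_simp [(tri_one_sub_pow_pos hz).ne']
  ring

/-- On `T`: the Jacobian is positive. -/
theorem tri_jac_pos {z : Fin 2 → ℝ} (hz : z ∈ Tri) : 0 < Jac z := by
  refine div_pos (mul_pos (mul_pos two_pos (pow_pos (tri_pos0 hz) 3)) (tri_one_sub_pow_one_pos hz)) ?_
  exact mul_pos (tri_w_pos hz) (pow_pos (tri_one_sub_pow_pos hz) 2)

/-! ## Injectivity -/

/-- `Ψ₂` is injective on `T`. -/
theorem injOn_pencil : InjOn Ψ₂ Tri := by
  intro z hz z' hz' h
  have h1 : z 1 = z' 1 := by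
    have := congrFun h 1
    simpa [Function.update_of_ne (show (1 : Fin 2) ≠ 0 by decide)] using this
  have h0 : wC z = wC z' := by
    have := congrFun h 0
    simpa using this
  have hsq : (z 0 ^ 4 - z 1 ^ 4) / (1 - z 0 ^ 4) = (z' 0 ^ 4 - z' 1 ^ 4) / (1 - z' 0 ^ 4) := by
    rw [← tri_w_sq hz, ← tri_w_sq hz']
    exact congrArg (· ^ 2) h0
  have hA := (tri_one_sub_pow_pos hz).ne'
  have hA' := (tri_one_sub_pow_pos hz').ne'
  rw [div_eq_div_iff hA hA'] at hsq
  rw [← h1] at hsq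
  have h4 : z 0 ^ 4 = z' 0 ^ 4 := by
    have ht : 0 < 1 - z 1 ^ 4 := tri_one_sub_pow_one_pos hz
    have : (z 0 ^ 4 - z' 0 ^ 4) * (1 - z 1 ^ 4) = 0 := by linear_combination hsq
    rcases mul_eq_zero.mp this with h | h
    · linarith
    · exact absurd h ht.ne'
  have h00 : z 0 = z' 0 := (pow_left_inj₀ (tri_pos0 hz).le (tri_pos0 hz').le four_ne_zero).mp h4
  funext i
  fin_cases i
  · exact h00
  · exact h1


/-! ## The image is the half-strip -/

/-- `Ψ₂` maps `T` into the half-strip. -/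
theorem pencil_mem_halfStrip {z : Fin 2 → ℝ} (hz : z ∈ Tri) : Ψ₂ z ∈ Hst := by
  refine ⟨?_, ?_, ?_⟩
  · simpa using tri_w_pos hz
  · simpa [Function.update_of_ne (show (1 : Fin 2) ≠ 0 by decide)] using hz.1
  · simpa [Function.update_of_ne (show (1 : Fin 2) ≠ 0 by decide)] using hz.2.1.trans hz.2.2

/-- The explicit inverse: for `s > 0`, `0 < t < 1`, the point `y = ((t⁴ + s²)/(1 + s²))^{1/4}` (written
with two square roots) lies in `(t, 1)` and has `w(y, t) = s`. -/
theorem pencil_inverse {s t : ℝ} (hs : 0 < s) (ht0 : 0 < t) (ht1 : t < 1) :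
    let y := Real.sqrt (Real.sqrt ((t ^ 4 + s ^ 2) / (1 + s ^ 2)))
    t < y ∧ y < 1 ∧ Real.sqrt ((y ^ 4 - t ^ 4) / (1 - y ^ 4)) = s := by
  intro y
  have ht4 : t ^ 4 < 1 := pow_lt_one₀ ht0.le ht1 four_ne_zero
  have hQpos : 0 < (t ^ 4 + s ^ 2) / (1 + s ^ 2) := by positivity
  have hy4 : y ^ 4 = (t ^ 4 + s ^ 2) / (1 + s ^ 2) := by
    have h1 : y ^ 2 = Real.sqrt ((t ^ 4 + s ^ 2) / (1 + s ^ 2)) := Real.sq_sqrt (Real.sqrt_nonneg _)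
    calc y ^ 4 = (y ^ 2) ^ 2 := by ring
      _ = (t ^ 4 + s ^ 2) / (1 + s ^ 2) := by rw [h1, Real.sq_sqrt hQpos.le]
  have hypos : 0 < y := Real.sqrt_pos.mpr (Real.sqrt_pos.mpr hQpos)
  have hQgt : t ^ 4 < (t ^ 4 + s ^ 2) / (1 + s ^ 2) := by
    rw [lt_div_iff₀ (by positivity)]
    nlinarith [mul_pos (pow_pos hs 2) (sub_pos.mpr ht4)]
  have hQlt : (t ^ 4 + s ^ 2) / (1 + s ^ 2) < 1 := by
    rw [div_lt_one (by positivity)]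
    linarith
  have hty : t < y := by
    have : t ^ 4 < y ^ 4 := by rw [hy4]; exact hQgt
    exact lt_of_pow_lt_pow_left₀ 4 hypos.le this
  have hy1 : y < 1 := by
    have : y ^ 4 < 1 ^ 4 := by rw [hy4, one_pow]; exact hQlt
    exact lt_of_pow_lt_pow_left₀ 4 zero_le_one this
  refine ⟨hty, hy1, ?_⟩
  have hden : (1 : ℝ) + s ^ 2 ≠ 0 := by positivity
  have h1t : (1 : ℝ) - t ^ 4 ≠ 0 := (sub_pos.mpr ht4).ne'
  have hnum' : (t ^ 4 + s ^ 2) / (1 + s ^ 2) - t ^ 4 = s ^ 2 * (1 - t ^ 4) / (1 + s ^ 2) := by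
    field_simp
    ring
  have hden' : 1 - (t ^ 4 + s ^ 2) / (1 + s ^ 2) = (1 - t ^ 4) / (1 + s ^ 2) := by
    field_simp
    ring
  have hrad : (y ^ 4 - t ^ 4) / (1 - y ^ 4) = s ^ 2 := by
    rw [hy4, hnum', hden', div_div_div_cancel_right₀ hden, mul_div_cancel_right₀ _ h1t]
  rw [hrad, Real.sqrt_sq hs.le]

/-- `Ψ₂ '' T` is the half-strip `{0 < z0} ∩ {0 < z1 < 1}`. -/
theorem image_pencil : Ψ₂ '' Tri = Hst := by
  refine Subset.antisymm ?_ ?_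
  · rintro _ ⟨z, hz, rfl⟩
    exact pencil_mem_halfStrip hz
  · intro v hv
    obtain ⟨hs, ht0, ht1⟩ := hv
    obtain ⟨hty, hy1, hw⟩ := pencil_inverse hs ht0 ht1
    set y := Real.sqrt (Real.sqrt ((v 1 ^ 4 + v 0 ^ 2) / (1 + v 0 ^ 2))) with hy
    refine ⟨Function.update v 0 y, ⟨?_, ?_, ?_⟩, ?_⟩
    · simpa [Function.update_of_ne (show (1 : Fin 2) ≠ 0 by decide)] using ht0
    · simpa [Function.update_of_ne (show (1 : Fin 2) ≠ 0 by decide)] using hty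
    · simpa using hy1
    · funext i
      fin_cases i
      · simpa [Function.update_of_ne (show (1 : Fin 2) ≠ 0 by decide)] using hw
      · simp

/-! ## Differentiability and the Jacobian -/

/-- The one-variable derivative: for fixed `t = z1`,
`d/dy √((y⁴ − t⁴)/(1 − y⁴)) = 2y³(1 − t⁴)/(w (1 − y⁴)²)` at `y = z0`. -/
theorem hasDerivAt_w_line {z : Fin 2 → ℝ} (hz : z ∈ Tri) :
    HasDerivAt (fun s : ℝ => Real.sqrt ((s ^ 4 - z 1 ^ 4) / (1 - s ^ 4))) (Jac z) (z 0) := by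
  have hA : (1 : ℝ) - z 0 ^ 4 ≠ 0 := (tri_one_sub_pow_pos hz).ne'
  have hnum : HasDerivAt (fun s : ℝ => s ^ 4 - z 1 ^ 4) (4 * z 0 ^ 3) (z 0) := by
    simpa using (hasDerivAt_pow 4 (z 0)).sub_const (z 1 ^ 4)
  have hden : HasDerivAt (fun s : ℝ => 1 - s ^ 4) (-(4 * z 0 ^ 3)) (z 0) := by
    simpa using (hasDerivAt_pow 4 (z 0)).const_sub 1
  have hq : HasDerivAt (fun s : ℝ => (s ^ 4 - z 1 ^ 4) / (1 - s ^ 4))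
      ((4 * z 0 ^ 3 * (1 - z 0 ^ 4) - (z 0 ^ 4 - z 1 ^ 4) * -(4 * z 0 ^ 3)) / (1 - z 0 ^ 4) ^ 2) (z 0) :=
    hnum.div hden hA
  have hsqrt := hq.sqrt (tri_radicand_pos hz).ne'
  refine hsqrt.congr_deriv ?_
  have hw : Real.sqrt ((z 0 ^ 4 - z 1 ^ 4) / (1 - z 0 ^ 4)) ≠ 0 := (tri_w_pos hz).ne'
  show (4 * z 0 ^ 3 * (1 - z 0 ^ 4) - (z 0 ^ 4 - z 1 ^ 4) * -(4 * z 0 ^ 3)) / (1 - z 0 ^ 4) ^ 2 /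
      (2 * Real.sqrt ((z 0 ^ 4 - z 1 ^ 4) / (1 - z 0 ^ 4))) =
    2 * z 0 ^ 3 * (1 - z 1 ^ 4) / (Real.sqrt ((z 0 ^ 4 - z 1 ^ 4) / (1 - z 0 ^ 4)) * (1 - z 0 ^ 4) ^ 2)
  generalize Real.sqrt ((z 0 ^ 4 - z 1 ^ 4) / (1 - z 0 ^ 4)) = w at hw ⊢
  field_simp
  ring

/-- `Ψ₂` is differentiable at every point of `T`, with Jacobian determinant `∂w/∂y` (one-coordinate
substitution, `stub_interiorLandenAux1`). -/
theorem hasFDerivAt_pencil {z : Fin 2 → ℝ} (hz : z ∈ Tri) :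
    ∃ L : (Fin 2 → ℝ) →L[ℝ] (Fin 2 → ℝ), HasFDerivAt Ψ₂ L z ∧ L.det = Jac z := by
  have hA : (1 : ℝ) - z 0 ^ 4 ≠ 0 := (tri_one_sub_pow_pos hz).ne'
  have hdiffq : DifferentiableAt ℝ (fun y : Fin 2 → ℝ => (y 0 ^ 4 - y 1 ^ 4) / (1 - y 0 ^ 4)) z := by
    refine differentiableAt_div ?_ ?_ hA
    · exact ((differentiableAt_apply 0 z).pow 4).sub ((differentiableAt_apply 1 z).pow 4)
    · exact (differentiableAt_const _).sub ((differentiableAt_apply 0 z).pow 4)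
  have hdiff : DifferentiableAt ℝ wC z := hdiffq.sqrt (tri_radicand_pos hz).ne'
  have hline : HasDerivAt (fun s : ℝ => wC (Function.update z 0 s)) (Jac z) (z 0) := by
    have h := hasDerivAt_w_line hz
    refine h.congr_of_eventuallyEq ?_
    refine Filter.Eventually.of_forall fun s => ?_
    simp
  exact stub_interiorLandenAux1 0 wC z (Jac z) hdiff hline

/-! ## The pull-back identity -/

/-- On `T`: `2y³/(√(1−y⁴)√(y⁴−t⁴)) = (1/(1 + w²))·|∂w/∂y|`. -/
theorem pullback_pencil {z : Fin 2 → ℝ} (hz : z ∈ Tri) :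
    2 * z 0 ^ 3 / (Real.sqrt (1 - z 0 ^ 4) * Real.sqrt (z 0 ^ 4 - z 1 ^ 4)) =
      1 / (1 + (wC z) ^ 2) * |Jac z| := by
  rw [abs_of_pos (tri_jac_pos hz), tri_one_add_w_sq hz]
  have hApos := tri_one_sub_pow_pos hz
  have hBpos := tri_pow_sub_pow_pos hz
  have hCpos := tri_one_sub_pow_one_pos hz
  set a := Real.sqrt (1 - z 0 ^ 4) with ha
  set b := Real.sqrt (z 0 ^ 4 - z 1 ^ 4) with hb
  have ha0 : 0 < a := Real.sqrt_pos.mpr hApos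
  have hb0 : 0 < b := Real.sqrt_pos.mpr hBpos
  have ha2 : a ^ 2 = 1 - z 0 ^ 4 := Real.sq_sqrt hApos.le
  have hb2 : b ^ 2 = z 0 ^ 4 - z 1 ^ 4 := Real.sq_sqrt hBpos.le
  have hw : Real.sqrt ((z 0 ^ 4 - z 1 ^ 4) / (1 - z 0 ^ 4)) = b / a := by
    rw [Real.sqrt_div' _ hApos.le]
  simp only [hw]
  rw [← ha2]
  field_simp

/-! ## The registered stub -/

/-- **Stub `stub_pencilCalculus`** of line `hyperbola-fibration-conic` (crux
stmt-KontsevichZagierPeriods-0280, `GpcLegendreLemniscatic`): injectivity, image, differentiability with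
Jacobian, and the pull-back identity of the conic rationalisation `Ψ₂ z = update z 0 √((z0⁴−z1⁴)/(1−z0⁴))`
on the triangle `{0 < z1 < z0 < 1}`. [folklore] -/
theorem stub_pencilCalculus :
    InjOn (fun z : Fin 2 → ℝ => Function.update z 0 (Real.sqrt ((z 0 ^ 4 - z 1 ^ 4) / (1 - z 0 ^ 4))))
        {z : Fin 2 → ℝ | 0 < z 1 ∧ z 1 < z 0 ∧ z 0 < 1} ∧
      (fun z : Fin 2 → ℝ => Function.update z 0 (Real.sqrt ((z 0 ^ 4 - z 1 ^ 4) / (1 - z 0 ^ 4)))) ''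
          {z : Fin 2 → ℝ | 0 < z 1 ∧ z 1 < z 0 ∧ z 0 < 1} = {z : Fin 2 → ℝ | 0 < z 0 ∧ 0 < z 1 ∧ z 1 < 1} ∧
      (∀ z ∈ {z : Fin 2 → ℝ | 0 < z 1 ∧ z 1 < z 0 ∧ z 0 < 1},
        ∃ L : (Fin 2 → ℝ) →L[ℝ] (Fin 2 → ℝ),
          HasFDerivAt (fun z : Fin 2 → ℝ =>
              Function.update z 0 (Real.sqrt ((z 0 ^ 4 - z 1 ^ 4) / (1 - z 0 ^ 4)))) L z ∧
            L.det = 2 * z 0 ^ 3 * (1 - z 1 ^ 4) /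
              (Real.sqrt ((z 0 ^ 4 - z 1 ^ 4) / (1 - z 0 ^ 4)) * (1 - z 0 ^ 4) ^ 2)) ∧
      (∀ z ∈ {z : Fin 2 → ℝ | 0 < z 1 ∧ z 1 < z 0 ∧ z 0 < 1},
        2 * z 0 ^ 3 / (Real.sqrt (1 - z 0 ^ 4) * Real.sqrt (z 0 ^ 4 - z 1 ^ 4)) =
          1 / (1 + Real.sqrt ((z 0 ^ 4 - z 1 ^ 4) / (1 - z 0 ^ 4)) ^ 2) *
            |2 * z 0 ^ 3 * (1 - z 1 ^ 4) /
              (Real.sqrt ((z 0 ^ 4 - z 1 ^ 4) / (1 - z 0 ^ 4)) * (1 - z 0 ^ 4) ^ 2)|) :=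
  ⟨injOn_pencil, image_pencil, fun _ hz => hasFDerivAt_pencil hz, fun _ hz => pullback_pencil hz⟩

end Summit.KontsevichZagierPeriods.Grothendieck.GpcLegendreLemniscaticLine
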